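import Summits.AtomisticToContinuum.HydrodynamicLimit.Theorems.LambertianContactSwapLambertianEulerCollisionalHeartOfInputs
import Summits.AtomisticToContinuum.HydrodynamicLimit.Theorems.LambertianContactSwapLambertianEulerKineticHeartOfInputs
import Summits.AtomisticToContinuum.HydrodynamicLimit.Theorems.LambertianContactSwapLambertianEulerInBandOfHearts
import Summits.AtomisticToContinuum.HydrodynamicLimit.Theorems.LambertianContactSwapLambertianEulerGaussianTailsCore
import Summits.AtomisticToContinuum.HydrodynamicLimit.Theorems.LambertianContactSwapLambertianEulerJcolPairBound
import Summits.AtomisticToContinuum.HydrodynamicLimit.Theorems.LambertianContactSwapLambertianEulerCollisionActivityCore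
import HarnessLib

/-!
# The crux from its four research inputs: `KCW-Λ → TL1G-core → CCW-Λ → CAT-core → LambertianEulerInBand` (line `Sketch`, crux stmt-11854, lead c9)

Support file (`--supports stmt-AtomisticToContinuum-11854`).  The composition of the whole line `Sketch` (leads c0–c9) as two sorry-free,
CONDITIONAL tree theorems, so that the guarded crux and the crux as typed can be cited by name with their exact research hypotheses:

* `lambertianEulerInBand_of_inputs` — the PACKING-GUARDED crux `…HeartsLog.LambertianEulerInBand` (the crux in the shape of the re-typed
  conjunct, D-0032) from the four research inputs of the line ALONE: the two window large-deviation bounds under local-Gibbs restart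
  KCW-Λ (`…KineticInputs.KineticClampedWindowLDLambda`) and CCW-Λ (`…CollisionalInputs.CollisionalClampedWindowLDLambda`), and the two
  EULER-FREE a-priori inputs on the Lambertian gas from local Gibbs data, TL1G-core (Gaussian `L¹` velocity tails, the hypothesis of
  `…GaussianTailsCore.gaussianVelocityTailsLambda_of_core`, p150128) and CAT-core (collision-activity tails, the second hypothesis of
  `…CollisionActivityCore.collisionActivityTailsLambda_of_core`, p152627).  Chain: TL1G-core ⇒ TL1G-Λ (p150128); pair bound p152321 + CAT-core ⇒
  CAT-Λ (p152627); KCW-Λ + TL1G-Λ ⇒ kinetic log-heart (p139979); CCW-Λ + CAT-Λ + TL1G-Λ ⇒ collisional log-heart (p146028); hearts ⇒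
  `LambertianEulerInBand` (p138618).
* `lambertianEuler_of_inputs` — the crux AS TYPED (`LambertianContactSwap.LambertianEuler`, and the sister copy) from the same four inputs plus
  dilute self-consistency (stmt-AtomisticToContinuum-3091, expected FALSE by its own chain; it only discharges the packing guard,
  `…InBandOfHearts.lambertianEuler_of_inBand`).

No new mathematics: definitional composition of landed theorems (registered sub-goals of the crux item).  Lead
prover-line-stmt-AtomisticToContinuum-11854-c9-0, 2026-08-17.
-/

noncomputable section

namespace Summit.AtomisticToContinuum.HydrodynamicLimit.Theorems.LambertianContactSwapLambertianEulerOfInputs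

open scoped BigOperators Topology ENNReal InnerProductSpace
open MeasureTheory ProbabilityTheory Filter Set InformationTheory
open Literature.MathematicalPhysics.KineticTheory
open Literature.Analysis.FluidPDE Literature.Analysis.FluidPDE.Alexander
open Summit.AtomisticToContinuum.HydrodynamicLimit.Theorems

/-- **The packing-guarded crux from the four research inputs of line `Sketch`**: KCW-Λ → TL1G-core → CCW-Λ → CAT-core →
`LambertianEulerInBand` (registered sub-goal `lambertianEulerInBand_of_inputs` of stmt-AtomisticToContinuum-11854; composition of p150128,
p152321, p152627, p139979, p146028, p138618). [cite: OllaVaradhanYau1993, §3–§4] -/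
theorem lambertianEulerInBand_of_inputs :
    LambertianContactSwapLambertianEulerKineticInputs.KineticClampedWindowLDLambda →
    (∀ (a₀ θ₀ : T3 → ℝ) (u₀ : T3 → V3), Continuous a₀ → Continuous θ₀ → Continuous u₀ →
      (∀ x, 0 < a₀ x) → (∀ x, 0 < θ₀ x) →
      ∃ σ₀ : ℝ, 0 < σ₀ ∧ ∀ σ : ℝ, 0 < σ → σ < σ₀ →
        ∀ Φ : (N : ℕ) → HardSphereFlow (Torus.geometry (Fin 3)) (hsDiameter σ N) (N + 1),
        ∀ t : ℝ, 0 < t → ∃ A a : ℝ, 0 < A ∧ 0 < a ∧ ∀ V : ℝ, 1 ≤ V → ∃ N₀ : ℕ, ∀ N : ℕ, N₀ ≤ N →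
          ∀ r' ∈ Set.Icc 0 t,
            ∫ p, (∑ i : Fin (N + 1),
                if V < ‖(lambertFlow (Torus.geometry (Fin 3)) (hsDiameter σ N) p.2 p.1 r' i).2‖ then
                  (1 + ‖(lambertFlow (Torus.geometry (Fin 3)) (hsDiameter σ N) p.2 p.1 r' i).2‖) ^ 3 else 0)
              ∂((localGibbsLaw σ a₀ u₀ θ₀ N (Φ N)).prod (lambertNoise (Fin 3))) ≤
            A * Real.exp (-(a * V ^ 2)) * ((N : ℝ) + 1)) →
    LambertianContactSwapLambertianEulerCollisionalInputs.CollisionalClampedWindowLDLambda →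
    (∀ (a₀ θ₀ : T3 → ℝ) (u₀ : T3 → V3), Continuous a₀ → Continuous θ₀ → Continuous u₀ →
      (∀ x, 0 < a₀ x) → (∀ x, 0 < θ₀ x) →
      ∃ σ₀ : ℝ, 0 < σ₀ ∧ ∀ σ : ℝ, 0 < σ → σ < σ₀ →
        ∀ Φ : (N : ℕ) → HardSphereFlow (Torus.geometry (Fin 3)) (hsDiameter σ N) (N + 1),
        ∀ t : ℝ, 0 < t → ∃ R₀ A a : ℝ, 1 ≤ R₀ ∧ 0 < A ∧ 0 < a ∧
          ∀ V : ℝ, 1 ≤ V → ∀ h₀ : ℝ, 0 < h₀ → ∃ N₀ : ℕ, ∀ N : ℕ, N₀ ≤ N →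
            ∀ (a' h : ℝ), 0 ≤ a' → h₀ ≤ h → h ≤ 2 * h₀ → a' + h ≤ t →
              (∫⁻ p, ENNReal.ofReal
                  (∑ m ∈ Finset.range (lambertCount (Torus.geometry (Fin 3)) (hsDiameter σ N) p.2 p.1 (a' + h)),
                    if a' < (lambertInstant (Torus.geometry (Fin 3)) (hsDiameter σ N) p.2 p.1 (m + 1)).toReal then
                      ∑ q : Fin (N + 1) × Fin (N + 1),
                        (incomingPairs (Torus.geometry (Fin 3)) (hsDiameter σ N)
                          (freeFlight (Torus.geometry (Fin 3))
                            (freeExitTime (Torus.geometry (Fin 3)) (hsDiameter σ N)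
                              (lambertStateAfter (Torus.geometry (Fin 3)) (hsDiameter σ N) p.2 p.1 m)).toReal
                            (lambertStateAfter (Torus.geometry (Fin 3)) (hsDiameter σ N) p.2 p.1 m))).indicator
                          (fun q' => if V ^ 2 < 1 + ‖(lambertStateAfter (Torus.geometry (Fin 3)) (hsDiameter σ N) p.2 p.1 m q'.1).2‖ ^ 2 +
                                ‖(lambertStateAfter (Torus.geometry (Fin 3)) (hsDiameter σ N) p.2 p.1 m q'.2).2‖ ^ 2 then
                              hsDiameter σ N * (1 + ‖(lambertStateAfter (Torus.geometry (Fin 3)) (hsDiameter σ N) p.2 p.1 m q'.1).2‖ ^ 2 +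
                                ‖(lambertStateAfter (Torus.geometry (Fin 3)) (hsDiameter σ N) p.2 p.1 m q'.2).2‖ ^ 2) else 0) q
                    else 0)
                ∂((localGibbsLaw σ a₀ u₀ θ₀ N (Φ N)).prod (lambertNoise (Fin 3)))) +
              (∫⁻ p, ENNReal.ofReal (hsDiameter σ N * V ^ 2 *
                  (((lambertCount (Torus.geometry (Fin 3)) (hsDiameter σ N) p.2 p.1 (a' + h) : ℕ) : ℝ) -
                    ((lambertCount (Torus.geometry (Fin 3)) (hsDiameter σ N) p.2 p.1 a' : ℕ) : ℝ) -
                    R₀ * h * ((N : ℝ) + 1) ^ (4 / 3 : ℝ)))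
                ∂((localGibbsLaw σ a₀ u₀ θ₀ N (Φ N)).prod (lambertNoise (Fin 3)))) ≤
              ENNReal.ofReal (A * Real.exp (-(a * V ^ 2)) * h * ((N : ℝ) + 1))) →
    LambertianContactSwapLambertianEulerHeartsLog.LambertianEulerInBand := by
  intro hKCW hTL hCCW hCAT
  have hTL1G : LambertianContactSwapLambertianEulerKineticInputs.GaussianVelocityTailsLambda :=
    LambertianContactSwapLambertianEulerGaussianTailsCore.gaussianVelocityTailsLambda_of_core hTL
  have hCATΛ : LambertianContactSwapLambertianEulerCollisionalInputs.CollisionActivityTailsLambda :=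
    LambertianContactSwapLambertianEulerCollisionActivityCore.collisionActivityTailsLambda_of_core
      LambertianContactSwapLambertianEulerJcolPairBound.abs_Jcol_le_pair hCAT
  exact LambertianContactSwapLambertianEulerInBandOfHearts.lambertianEulerInBand_of_hearts
    (LambertianContactSwapLambertianEulerKineticHeartOfInputs.kineticOneBlockInMeanLambdaLog_of_inputs hKCW hTL1G)
    (LambertianContactSwapLambertianEulerCollisionalHeartOfInputs.collisionalOneBlockInMeanLambdaLog_of_inputs hCCW hCATΛ hTL1G)

/-- **The crux AS TYPED from the four research inputs and dilute self-consistency** (stmt-3091, expected false; it only discharges the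
packing guard): KCW-Λ → TL1G-core → CCW-Λ → CAT-core → DSC → `LambertianContactSwap.LambertianEuler` (registered sub-goal
`lambertianEuler_of_inputs`; `lambertianEulerInBand_of_inputs` + `…InBandOfHearts.lambertianEuler_of_inBand`). [cite: OllaVaradhanYau1993, §1] -/
theorem lambertianEuler_of_inputs :
    LambertianContactSwapLambertianEulerKineticInputs.KineticClampedWindowLDLambda →
    (∀ (a₀ θ₀ : T3 → ℝ) (u₀ : T3 → V3), Continuous a₀ → Continuous θ₀ → Continuous u₀ →
      (∀ x, 0 < a₀ x) → (∀ x, 0 < θ₀ x) →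
      ∃ σ₀ : ℝ, 0 < σ₀ ∧ ∀ σ : ℝ, 0 < σ → σ < σ₀ →
        ∀ Φ : (N : ℕ) → HardSphereFlow (Torus.geometry (Fin 3)) (hsDiameter σ N) (N + 1),
        ∀ t : ℝ, 0 < t → ∃ A a : ℝ, 0 < A ∧ 0 < a ∧ ∀ V : ℝ, 1 ≤ V → ∃ N₀ : ℕ, ∀ N : ℕ, N₀ ≤ N →
          ∀ r' ∈ Set.Icc 0 t,
            ∫ p, (∑ i : Fin (N + 1),
                if V < ‖(lambertFlow (Torus.geometry (Fin 3)) (hsDiameter σ N) p.2 p.1 r' i).2‖ then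
                  (1 + ‖(lambertFlow (Torus.geometry (Fin 3)) (hsDiameter σ N) p.2 p.1 r' i).2‖) ^ 3 else 0)
              ∂((localGibbsLaw σ a₀ u₀ θ₀ N (Φ N)).prod (lambertNoise (Fin 3))) ≤
            A * Real.exp (-(a * V ^ 2)) * ((N : ℝ) + 1)) →
    LambertianContactSwapLambertianEulerCollisionalInputs.CollisionalClampedWindowLDLambda →
    (∀ (a₀ θ₀ : T3 → ℝ) (u₀ : T3 → V3), Continuous a₀ → Continuous θ₀ → Continuous u₀ →
      (∀ x, 0 < a₀ x) → (∀ x, 0 < θ₀ x) →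
      ∃ σ₀ : ℝ, 0 < σ₀ ∧ ∀ σ : ℝ, 0 < σ → σ < σ₀ →
        ∀ Φ : (N : ℕ) → HardSphereFlow (Torus.geometry (Fin 3)) (hsDiameter σ N) (N + 1),
        ∀ t : ℝ, 0 < t → ∃ R₀ A a : ℝ, 1 ≤ R₀ ∧ 0 < A ∧ 0 < a ∧
          ∀ V : ℝ, 1 ≤ V → ∀ h₀ : ℝ, 0 < h₀ → ∃ N₀ : ℕ, ∀ N : ℕ, N₀ ≤ N →
            ∀ (a' h : ℝ), 0 ≤ a' → h₀ ≤ h → h ≤ 2 * h₀ → a' + h ≤ t →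
              (∫⁻ p, ENNReal.ofReal
                  (∑ m ∈ Finset.range (lambertCount (Torus.geometry (Fin 3)) (hsDiameter σ N) p.2 p.1 (a' + h)),
                    if a' < (lambertInstant (Torus.geometry (Fin 3)) (hsDiameter σ N) p.2 p.1 (m + 1)).toReal then
                      ∑ q : Fin (N + 1) × Fin (N + 1),
                        (incomingPairs (Torus.geometry (Fin 3)) (hsDiameter σ N)
                          (freeFlight (Torus.geometry (Fin 3))
                            (freeExitTime (Torus.geometry (Fin 3)) (hsDiameter σ N)
                              (lambertStateAfter (Torus.geometry (Fin 3)) (hsDiameter σ N) p.2 p.1 m)).toReal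
                            (lambertStateAfter (Torus.geometry (Fin 3)) (hsDiameter σ N) p.2 p.1 m))).indicator
                          (fun q' => if V ^ 2 < 1 + ‖(lambertStateAfter (Torus.geometry (Fin 3)) (hsDiameter σ N) p.2 p.1 m q'.1).2‖ ^ 2 +
                                ‖(lambertStateAfter (Torus.geometry (Fin 3)) (hsDiameter σ N) p.2 p.1 m q'.2).2‖ ^ 2 then
                              hsDiameter σ N * (1 + ‖(lambertStateAfter (Torus.geometry (Fin 3)) (hsDiameter σ N) p.2 p.1 m q'.1).2‖ ^ 2 +
                                ‖(lambertStateAfter (Torus.geometry (Fin 3)) (hsDiameter σ N) p.2 p.1 m q'.2).2‖ ^ 2) else 0) q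
                    else 0)
                ∂((localGibbsLaw σ a₀ u₀ θ₀ N (Φ N)).prod (lambertNoise (Fin 3)))) +
              (∫⁻ p, ENNReal.ofReal (hsDiameter σ N * V ^ 2 *
                  (((lambertCount (Torus.geometry (Fin 3)) (hsDiameter σ N) p.2 p.1 (a' + h) : ℕ) : ℝ) -
                    ((lambertCount (Torus.geometry (Fin 3)) (hsDiameter σ N) p.2 p.1 a' : ℕ) : ℝ) -
                    R₀ * h * ((N : ℝ) + 1) ^ (4 / 3 : ℝ)))
                ∂((localGibbsLaw σ a₀ u₀ θ₀ N (Φ N)).prod (lambertNoise (Fin 3)))) ≤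
              ENNReal.ofReal (A * Real.exp (-(a * V ^ 2)) * h * ((N : ℝ) + 1))) →
    (∀ η : ℝ, 0 < η → ∀ (a₀ θ₀ : T3 → ℝ) (u₀ : T3 → V3), Continuous a₀ → Continuous θ₀ → Continuous u₀ → (∀ x, 0 < a₀ x) → (∀ x, 0 < θ₀ x) → ∃ σ₀ : ℝ, 0 < σ₀ ∧ ∀ σ : ℝ, 0 < σ → σ < σ₀ → ∀ (T : ℝ) (ρ θ : ℝ → T3 → ℝ) (u : ℝ → T3 → V3), IsHardSphereEulerSolution σ T ρ u θ → ∀ Φ : (N : ℕ) → HardSphereFlow (Torus.geometry (Fin 3)) (hsDiameter σ N) (N + 1), TendstoHydroFieldsAt (fun N => localGibbsLaw σ a₀ u₀ θ₀ N (Φ N)) Φ ρ u θ 0 → ∀ t ∈ Set.Ico 0 T, ∀ x, ρ t x * σ ^ 3 < η) →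
    Summit.AtomisticToContinuum.HydrodynamicLimit.Theses.LambertianContactSwap.LambertianEuler :=
  fun hKCW hTL hCCW hCAT hDSC =>
    LambertianContactSwapLambertianEulerInBandOfHearts.lambertianEuler_of_inBand
      (lambertianEulerInBand_of_inputs hKCW hTL hCCW hCAT) hDSC

/-- The same composition read as the sister route's copy of the crux (`LindebergRandomFuture.LambertianEuler`, byte-identical body).
[cite: OllaVaradhanYau1993, §1] -/
theorem lambertianEuler_sister_of_inputs :
    LambertianContactSwapLambertianEulerKineticInputs.KineticClampedWindowLDLambda →
    (∀ (a₀ θ₀ : T3 → ℝ) (u₀ : T3 → V3), Continuous a₀ → Continuous θ₀ → Continuous u₀ →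
      (∀ x, 0 < a₀ x) → (∀ x, 0 < θ₀ x) →
      ∃ σ₀ : ℝ, 0 < σ₀ ∧ ∀ σ : ℝ, 0 < σ → σ < σ₀ →
        ∀ Φ : (N : ℕ) → HardSphereFlow (Torus.geometry (Fin 3)) (hsDiameter σ N) (N + 1),
        ∀ t : ℝ, 0 < t → ∃ A a : ℝ, 0 < A ∧ 0 < a ∧ ∀ V : ℝ, 1 ≤ V → ∃ N₀ : ℕ, ∀ N : ℕ, N₀ ≤ N →
          ∀ r' ∈ Set.Icc 0 t,
            ∫ p, (∑ i : Fin (N + 1),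
                if V < ‖(lambertFlow (Torus.geometry (Fin 3)) (hsDiameter σ N) p.2 p.1 r' i).2‖ then
                  (1 + ‖(lambertFlow (Torus.geometry (Fin 3)) (hsDiameter σ N) p.2 p.1 r' i).2‖) ^ 3 else 0)
              ∂((localGibbsLaw σ a₀ u₀ θ₀ N (Φ N)).prod (lambertNoise (Fin 3))) ≤
            A * Real.exp (-(a * V ^ 2)) * ((N : ℝ) + 1)) →
    LambertianContactSwapLambertianEulerCollisionalInputs.CollisionalClampedWindowLDLambda →
    (∀ (a₀ θ₀ : T3 → ℝ) (u₀ : T3 → V3), Continuous a₀ → Continuous θ₀ → Continuous u₀ →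
      (∀ x, 0 < a₀ x) → (∀ x, 0 < θ₀ x) →
      ∃ σ₀ : ℝ, 0 < σ₀ ∧ ∀ σ : ℝ, 0 < σ → σ < σ₀ →
        ∀ Φ : (N : ℕ) → HardSphereFlow (Torus.geometry (Fin 3)) (hsDiameter σ N) (N + 1),
        ∀ t : ℝ, 0 < t → ∃ R₀ A a : ℝ, 1 ≤ R₀ ∧ 0 < A ∧ 0 < a ∧
          ∀ V : ℝ, 1 ≤ V → ∀ h₀ : ℝ, 0 < h₀ → ∃ N₀ : ℕ, ∀ N : ℕ, N₀ ≤ N →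
            ∀ (a' h : ℝ), 0 ≤ a' → h₀ ≤ h → h ≤ 2 * h₀ → a' + h ≤ t →
              (∫⁻ p, ENNReal.ofReal
                  (∑ m ∈ Finset.range (lambertCount (Torus.geometry (Fin 3)) (hsDiameter σ N) p.2 p.1 (a' + h)),
                    if a' < (lambertInstant (Torus.geometry (Fin 3)) (hsDiameter σ N) p.2 p.1 (m + 1)).toReal then
                      ∑ q : Fin (N + 1) × Fin (N + 1),
                        (incomingPairs (Torus.geometry (Fin 3)) (hsDiameter σ N)
                          (freeFlight (Torus.geometry (Fin 3))
                            (freeExitTime (Torus.geometry (Fin 3)) (hsDiameter σ N)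
                              (lambertStateAfter (Torus.geometry (Fin 3)) (hsDiameter σ N) p.2 p.1 m)).toReal
                            (lambertStateAfter (Torus.geometry (Fin 3)) (hsDiameter σ N) p.2 p.1 m))).indicator
                          (fun q' => if V ^ 2 < 1 + ‖(lambertStateAfter (Torus.geometry (Fin 3)) (hsDiameter σ N) p.2 p.1 m q'.1).2‖ ^ 2 +
                                ‖(lambertStateAfter (Torus.geometry (Fin 3)) (hsDiameter σ N) p.2 p.1 m q'.2).2‖ ^ 2 then
                              hsDiameter σ N * (1 + ‖(lambertStateAfter (Torus.geometry (Fin 3)) (hsDiameter σ N) p.2 p.1 m q'.1).2‖ ^ 2 +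
                                ‖(lambertStateAfter (Torus.geometry (Fin 3)) (hsDiameter σ N) p.2 p.1 m q'.2).2‖ ^ 2) else 0) q
                    else 0)
                ∂((localGibbsLaw σ a₀ u₀ θ₀ N (Φ N)).prod (lambertNoise (Fin 3)))) +
              (∫⁻ p, ENNReal.ofReal (hsDiameter σ N * V ^ 2 *
                  (((lambertCount (Torus.geometry (Fin 3)) (hsDiameter σ N) p.2 p.1 (a' + h) : ℕ) : ℝ) -
                    ((lambertCount (Torus.geometry (Fin 3)) (hsDiameter σ N) p.2 p.1 a' : ℕ) : ℝ) -
                    R₀ * h * ((N : ℝ) + 1) ^ (4 / 3 : ℝ)))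
                ∂((localGibbsLaw σ a₀ u₀ θ₀ N (Φ N)).prod (lambertNoise (Fin 3)))) ≤
              ENNReal.ofReal (A * Real.exp (-(a * V ^ 2)) * h * ((N : ℝ) + 1))) →
    (∀ η : ℝ, 0 < η → ∀ (a₀ θ₀ : T3 → ℝ) (u₀ : T3 → V3), Continuous a₀ → Continuous θ₀ → Continuous u₀ → (∀ x, 0 < a₀ x) → (∀ x, 0 < θ₀ x) → ∃ σ₀ : ℝ, 0 < σ₀ ∧ ∀ σ : ℝ, 0 < σ → σ < σ₀ → ∀ (T : ℝ) (ρ θ : ℝ → T3 → ℝ) (u : ℝ → T3 → V3), IsHardSphereEulerSolution σ T ρ u θ → ∀ Φ : (N : ℕ) → HardSphereFlow (Torus.geometry (Fin 3)) (hsDiameter σ N) (N + 1), TendstoHydroFieldsAt (fun N => localGibbsLaw σ a₀ u₀ θ₀ N (Φ N)) Φ ρ u θ 0 → ∀ t ∈ Set.Ico 0 T, ∀ x, ρ t x * σ ^ 3 < η) →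
    Summit.AtomisticToContinuum.HydrodynamicLimit.Theses.LindebergRandomFuture.LambertianEuler :=
  fun hKCW hTL hCCW hCAT hDSC => lambertianEuler_of_inputs hKCW hTL hCCW hCAT hDSC

end Summit.AtomisticToContinuum.HydrodynamicLimit.Theorems.LambertianContactSwapLambertianEulerOfInputs
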